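import Mathlib
import HarnessLib

/-!
# Bilinear parallelogram bounds from second differences along lines: `‖Δ_yΔ_z f(q)‖ ≤ 4M‖y‖‖z‖`
# (the elementary `C^{1,1}` step behind the `ℓ = 2` slots of [ABKM19] Lemma 8.4 / Lemma 12.6)

The second-order hypotheses of the fine-tuning fixed point ([ABKM19] Lemma 12.6 in `C^{1,1}` form, tree:
`RGFlow.secondDiff_initial_le_of_isTunedQ`, hypotheses `hA2`, `hB2`, `hS2`) ask for PARALLELOGRAM second
differences `f(q+y+z) − f(q+y) − f(q+z) + f(q)` of size `≲ ‖y‖·‖z‖` — BILINEAR in the two increments —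
while the finite-range decomposition (clause (iv) of `TorusFRD`) controls the dependence on the tuning
parameter only ALONG LINES (`s ↦ 𝒞_{A+sB,k}` and its `s`-derivatives).  The passage is elementary and
dimension-free: a bound `‖f(x+2h) − 2f(x+h) + f(x)‖ ≤ M‖h‖²` for second differences along lines on a convex
set gives `‖Δ_yΔ_z f(q)‖ ≤ 2M·max(‖y‖,‖z‖)²` by the two-midpoint identity, and the bilinear form follows by
cutting the longer increment into `n ≈ ‖z‖/‖y‖` pieces of length `≤ ‖y‖` and telescoping:

* `secondDiff_eq_midpoint` — `Δ_yΔ_z f(q) = [f(q+y+z) − 2f(m) + f(q)] − [f(q+y) − 2f(m) + f(q+z)]`,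
  `m = q + (y+z)/2`;
* `norm_secondDiff_le_sq_max` — `‖Δ_yΔ_z f(q)‖ ≤ 2M max(‖y‖,‖z‖)²`;
* `secondDiff_sum_telescope` — `Δ_yΔ_{nw} f(q) = Σ_{i<n} Δ_yΔ_w f(q + iw)`;
* **`norm_secondDiff_le_bilinear`** — `‖f(q+y+z) − f(q+y) − f(q+z) + f(q)‖ ≤ 4M‖y‖‖z‖` whenever the four
  corners lie in a convex set on which the line bound holds.

Everything is proved; no named fact.

## References
* S. Adams, S. Buchholz, R. Kotecký, S. Müller, arXiv:1910.13564, Lemma 8.4 (`ℓ = 2`), Lemma 12.6, Theorem 2.2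
  [AdamsBuchholzKoteckyMuller2019].
-/

noncomputable section

namespace Literature.MathematicalPhysics.StatisticalMechanics.GradientRG

open Set

variable {E F : Type*} [NormedAddCommGroup E] [NormedSpace ℝ E] [NormedAddCommGroup F] [NormedSpace ℝ F]

/-- Points of the parallelogram `q + t z + u y`, `t, u ∈ [0,1]`, lie in every convex set containing its four
corners. [cite: AdamsBuchholzKoteckyMuller2019, Lemma 12.6 (the ball of tuning parameters is convex)] -/
theorem parallelogram_mem_convex {s : Set E} (hs : Convex ℝ s) {q y z : E} (hq : q ∈ s) (hqy : q + y ∈ s)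
    (hqz : q + z ∈ s) (hqyz : q + y + z ∈ s) {t u : ℝ} (ht : t ∈ Icc (0 : ℝ) 1) (hu : u ∈ Icc (0 : ℝ) 1) :
    q + t • z + u • y ∈ s := by
  have h1 : q + t • z ∈ s := by
    have := hs.add_smul_sub_mem hq hqz ht
    simpa using this
  have h2 : q + y + t • z ∈ s := by
    have := hs.add_smul_sub_mem hqy hqyz ht
    simpa [add_assoc] using this
  have h3 := hs.add_smul_sub_mem h1 h2 hu
  have e : q + t • z + u • (q + y + t • z - (q + t • z)) = q + t • z + u • y := by
    congr 1; abel_nf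
  rw [e] at h3
  exact h3

/-- **The two-midpoint identity**: with `m = q + ½(y+z)`,
`f(q+y+z) − f(q+y) − f(q+z) + f(q) = [f(q+y+z) − 2f(m) + f(q)] − [f(q+y) − 2f(m) + f(q+z)]`.
[cite: AdamsBuchholzKoteckyMuller2019, Lemma 8.4] -/
theorem secondDiff_eq_midpoint (f : E → F) (q y z : E) :
    f (q + y + z) - f (q + y) - f (q + z) + f q =
      (f (q + (2 : ℝ) • ((1 / 2 : ℝ) • (y + z))) - (2 : ℝ) • f (q + (1 / 2 : ℝ) • (y + z)) + f q) -
        (f (q + y + (2 : ℝ) • ((1 / 2 : ℝ) • (z - y))) - (2 : ℝ) • f (q + y + (1 / 2 : ℝ) • (z - y)) + f (q + y)) := by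
  have e1 : q + (2 : ℝ) • ((1 / 2 : ℝ) • (y + z)) = q + y + z := by
    rw [smul_smul, show (2 : ℝ) * (1 / 2) = 1 by norm_num, one_smul]; abel
  have e2 : q + y + (2 : ℝ) • ((1 / 2 : ℝ) • (z - y)) = q + z := by
    rw [smul_smul, show (2 : ℝ) * (1 / 2) = 1 by norm_num, one_smul]; abel
  have e3 : q + y + (1 / 2 : ℝ) • (z - y) = q + (1 / 2 : ℝ) • (y + z) := by
    rw [smul_sub, smul_add]
    have : y = (1 / 2 : ℝ) • y + (1 / 2 : ℝ) • y := by rw [← add_smul]; norm_num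
    calc q + y + ((1 / 2 : ℝ) • z - (1 / 2 : ℝ) • y)
        = q + ((1 / 2 : ℝ) • y + (1 / 2 : ℝ) • y) + ((1 / 2 : ℝ) • z - (1 / 2 : ℝ) • y) := by rw [← this]
      _ = q + ((1 / 2 : ℝ) • y + (1 / 2 : ℝ) • z) := by abel
  rw [e1, e2, e3]
  abel

/-- **Parallelogram second differences from line second differences, square form**: if
`‖f(x+2h) − 2f(x+h) + f(x)‖ ≤ M‖h‖²` whenever `x, x+h, x+2h ∈ s` (`s` convex), then for four corners in `s`
`‖f(q+y+z) − f(q+y) − f(q+z) + f(q)‖ ≤ 2M·max(‖y‖,‖z‖)²`. [cite: AdamsBuchholzKoteckyMuller2019, Lemma 8.4] -/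
theorem norm_secondDiff_le_sq_max {s : Set E} (hs : Convex ℝ s) {f : E → F} {M : ℝ} (hM : 0 ≤ M)
    (hline : ∀ x h : E, x ∈ s → x + h ∈ s → x + (2 : ℝ) • h ∈ s →
      ‖f (x + (2 : ℝ) • h) - (2 : ℝ) • f (x + h) + f x‖ ≤ M * ‖h‖ ^ 2)
    {q y z : E} (hq : q ∈ s) (hqy : q + y ∈ s) (hqz : q + z ∈ s) (hqyz : q + y + z ∈ s) :
    ‖f (q + y + z) - f (q + y) - f (q + z) + f q‖ ≤ 2 * M * max ‖y‖ ‖z‖ ^ 2 := by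
  rw [secondDiff_eq_midpoint]
  -- the midpoint lies in `s`
  have hm : q + (1 / 2 : ℝ) • (y + z) ∈ s := by
    have := parallelogram_mem_convex hs hq hqy hqz hqyz (t := 1 / 2) (u := 1 / 2)
      ⟨by norm_num, by norm_num⟩ ⟨by norm_num, by norm_num⟩
    rw [smul_add]
    convert this using 1
    abel
  have hm' : q + y + (1 / 2 : ℝ) • (z - y) ∈ s := by
    have e3 : q + y + (1 / 2 : ℝ) • (z - y) = q + (1 / 2 : ℝ) • (y + z) := by
      rw [smul_sub, smul_add]
      have : y = (1 / 2 : ℝ) • y + (1 / 2 : ℝ) • y := by rw [← add_smul]; norm_num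
      calc q + y + ((1 / 2 : ℝ) • z - (1 / 2 : ℝ) • y)
          = q + ((1 / 2 : ℝ) • y + (1 / 2 : ℝ) • y) + ((1 / 2 : ℝ) • z - (1 / 2 : ℝ) • y) := by rw [← this]
        _ = q + ((1 / 2 : ℝ) • y + (1 / 2 : ℝ) • z) := by abel
    rw [e3]; exact hm
  have h2a : q + (2 : ℝ) • ((1 / 2 : ℝ) • (y + z)) ∈ s := by
    rw [smul_smul, show (2 : ℝ) * (1 / 2) = 1 by norm_num, one_smul, ← add_assoc]; exact hqyz
  have h2b : q + y + (2 : ℝ) • ((1 / 2 : ℝ) • (z - y)) ∈ s := by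
    rw [smul_smul, show (2 : ℝ) * (1 / 2) = 1 by norm_num, one_smul]
    have : q + y + (z - y) = q + z := by abel
    rw [this]; exact hqz
  have hA := hline q ((1 / 2 : ℝ) • (y + z)) hq hm h2a
  have hB := hline (q + y) ((1 / 2 : ℝ) • (z - y)) hqy hm' h2b
  have hn1 : ‖(1 / 2 : ℝ) • (y + z)‖ ≤ max ‖y‖ ‖z‖ := by
    rw [norm_smul, Real.norm_of_nonneg (by norm_num : (0 : ℝ) ≤ 1 / 2)]
    calc (1 / 2 : ℝ) * ‖y + z‖ ≤ (1 / 2) * (‖y‖ + ‖z‖) := by gcongr; exact norm_add_le _ _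
      _ ≤ max ‖y‖ ‖z‖ := by
          have := le_max_left ‖y‖ ‖z‖; have := le_max_right ‖y‖ ‖z‖; linarith
  have hn2 : ‖(1 / 2 : ℝ) • (z - y)‖ ≤ max ‖y‖ ‖z‖ := by
    rw [norm_smul, Real.norm_of_nonneg (by norm_num : (0 : ℝ) ≤ 1 / 2)]
    calc (1 / 2 : ℝ) * ‖z - y‖ ≤ (1 / 2) * (‖z‖ + ‖y‖) := by gcongr; exact norm_sub_le _ _
      _ ≤ max ‖y‖ ‖z‖ := by
          have := le_max_left ‖y‖ ‖z‖; have := le_max_right ‖y‖ ‖z‖; linarith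
  have hmx : 0 ≤ max ‖y‖ ‖z‖ := le_max_of_le_left (norm_nonneg _)
  calc ‖(f (q + (2 : ℝ) • ((1 / 2 : ℝ) • (y + z))) - (2 : ℝ) • f (q + (1 / 2 : ℝ) • (y + z)) + f q) -
        (f (q + y + (2 : ℝ) • ((1 / 2 : ℝ) • (z - y))) - (2 : ℝ) • f (q + y + (1 / 2 : ℝ) • (z - y)) + f (q + y))‖
      ≤ M * ‖(1 / 2 : ℝ) • (y + z)‖ ^ 2 + M * ‖(1 / 2 : ℝ) • (z - y)‖ ^ 2 :=
        (norm_sub_le _ _).trans (add_le_add hA hB)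
    _ ≤ M * max ‖y‖ ‖z‖ ^ 2 + M * max ‖y‖ ‖z‖ ^ 2 := by
        gcongr
    _ = 2 * M * max ‖y‖ ‖z‖ ^ 2 := by ring

omit [NormedSpace ℝ F] in
/-- **Telescoping a parallelogram along one side**: `Δ_yΔ_{n•w} f(q) = Σ_{i<n} Δ_yΔ_w f(q + i•w)`.
[cite: AdamsBuchholzKoteckyMuller2019, Lemma 8.4] -/
theorem secondDiff_sum_telescope (f : E → F) (q y w : E) (n : ℕ) :
    ∑ i ∈ Finset.range n, (f (q + (i : ℝ) • w + y + w) - f (q + (i : ℝ) • w + y) - f (q + (i : ℝ) • w + w)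
      + f (q + (i : ℝ) • w)) =
      f (q + y + (n : ℝ) • w) - f (q + y) - f (q + (n : ℝ) • w) + f q := by
  induction n with
  | zero => simp
  | succ n ih =>
    rw [Finset.sum_range_succ, ih]
    have e1 : q + (n : ℝ) • w + y + w = q + y + ((n + 1 : ℕ) : ℝ) • w := by
      push_cast; rw [add_smul, one_smul]; abel
    have e2 : q + (n : ℝ) • w + w = q + ((n + 1 : ℕ) : ℝ) • w := by
      push_cast; rw [add_smul, one_smul]; abel
    have e3 : q + (n : ℝ) • w + y = q + y + (n : ℝ) • w := by abel
    rw [e1, e2, e3]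
    abel

/-- **Bilinear parallelogram bound from line second differences** (module docstring): if
`‖f(x+2h) − 2f(x+h) + f(x)‖ ≤ M‖h‖²` whenever `x, x+h, x+2h` lie in the convex set `s`, then for every
parallelogram with corners `q, q+y, q+z, q+y+z ∈ s`:
`‖f(q+y+z) − f(q+y) − f(q+z) + f(q)‖ ≤ 4M‖y‖‖z‖`. [cite: AdamsBuchholzKoteckyMuller2019, Lemma 8.4 / Lemma 12.6] -/
theorem norm_secondDiff_le_bilinear {s : Set E} (hs : Convex ℝ s) {f : E → F} {M : ℝ} (hM : 0 ≤ M)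
    (hline : ∀ x h : E, x ∈ s → x + h ∈ s → x + (2 : ℝ) • h ∈ s →
      ‖f (x + (2 : ℝ) • h) - (2 : ℝ) • f (x + h) + f x‖ ≤ M * ‖h‖ ^ 2)
    {q y z : E} (hq : q ∈ s) (hqy : q + y ∈ s) (hqz : q + z ∈ s) (hqyz : q + y + z ∈ s) :
    ‖f (q + y + z) - f (q + y) - f (q + z) + f q‖ ≤ 4 * M * ‖y‖ * ‖z‖ := by
  -- reduce to `‖y‖ ≤ ‖z‖` by symmetry
  wlog hyz : ‖y‖ ≤ ‖z‖ generalizing y z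
  · have h := this hqz hqy (by rw [add_right_comm]; exact hqyz) (le_of_not_ge hyz)
    have e : f (q + z + y) - f (q + z) - f (q + y) + f q = f (q + y + z) - f (q + y) - f (q + z) + f q := by
      rw [add_right_comm q z y]; abel
    rw [e] at h
    linarith [h]
  by_cases hy0 : ‖y‖ = 0
  · have hy : y = 0 := norm_eq_zero.1 hy0
    subst hy
    simp
  have hypos : 0 < ‖y‖ := lt_of_le_of_ne (norm_nonneg _) (Ne.symm hy0)
  -- cut `z` into `n` pieces of length `≤ ‖y‖`
  set n : ℕ := ⌈‖z‖ / ‖y‖⌉₊ with hndef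
  have hn1 : 1 ≤ n := by
    rw [hndef, Nat.one_le_ceil_iff]
    exact div_pos (lt_of_lt_of_le hypos hyz) hypos
  have hnpos : (0 : ℝ) < n := by exact_mod_cast hn1
  have hnle : (n : ℝ) ≤ ‖z‖ / ‖y‖ + 1 := by rw [hndef]; exact (Nat.ceil_lt_add_one (by positivity)).le
  have hnge : ‖z‖ / ‖y‖ ≤ n := by rw [hndef]; exact Nat.le_ceil _
  set w : E := (1 / (n : ℝ)) • z with hwdef
  have hnw : (n : ℝ) • w = z := by rw [hwdef, smul_smul]; field_simp; rw [one_smul]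
  have hwnorm : ‖w‖ = ‖z‖ / n := by
    rw [hwdef, norm_smul, Real.norm_of_nonneg (by positivity)]; ring
  have hwy : ‖w‖ ≤ ‖y‖ := by
    rw [hwnorm, div_le_iff₀ hnpos]
    calc ‖z‖ = ‖z‖ / ‖y‖ * ‖y‖ := by field_simp
      _ ≤ n * ‖y‖ := mul_le_mul_of_nonneg_right hnge (norm_nonneg _)
      _ = ‖y‖ * n := mul_comm _ _
  -- every small parallelogram has its corners in `s`
  have hcorner : ∀ i : ℕ, i ≤ n → ∀ u ∈ Icc (0 : ℝ) 1, q + (i : ℝ) • w + u • y ∈ s := by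
    intro i hi u hu
    have ht : ((i : ℝ) / n) ∈ Icc (0 : ℝ) 1 :=
      ⟨by positivity, by rw [div_le_one hnpos]; exact_mod_cast hi⟩
    have h := parallelogram_mem_convex hs hq hqy hqz hqyz ht hu
    have e : ((i : ℝ) / n) • z = (i : ℝ) • w := by rw [hwdef, smul_smul]; congr 1; field_simp
    rw [e] at h
    exact h
  have hterm : ∀ i ∈ Finset.range n,
      ‖f (q + (i : ℝ) • w + y + w) - f (q + (i : ℝ) • w + y) - f (q + (i : ℝ) • w + w) + f (q + (i : ℝ) • w)‖ ≤
        2 * M * ‖y‖ ^ 2 := by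
    intro i hi
    have hi' : i + 1 ≤ n := Finset.mem_range.1 hi
    have h0 : q + (i : ℝ) • w ∈ s := by simpa using hcorner i (by omega) 0 ⟨le_rfl, zero_le_one⟩
    have h1 : q + (i : ℝ) • w + y ∈ s := by simpa using hcorner i (by omega) 1 ⟨zero_le_one, le_rfl⟩
    have h2 : q + (i : ℝ) • w + w ∈ s := by
      have := hcorner (i + 1) hi' 0 ⟨le_rfl, zero_le_one⟩
      simp only [zero_smul, add_zero, Nat.cast_add, Nat.cast_one, add_smul, one_smul, ← add_assoc] at this
      exact this
    have h3 : q + (i : ℝ) • w + y + w ∈ s := by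
      have := hcorner (i + 1) hi' 1 ⟨zero_le_one, le_rfl⟩
      simp only [one_smul, Nat.cast_add, Nat.cast_one, add_smul, ← add_assoc] at this
      rw [add_right_comm (q + (i : ℝ) • w) y w]
      exact this
    have h := norm_secondDiff_le_sq_max hs hM hline h0 h1 h2 h3
    have hmax : max ‖y‖ ‖w‖ = ‖y‖ := max_eq_left hwy
    rw [hmax] at h
    exact h
  have hsum := secondDiff_sum_telescope f q y w n
  rw [hnw] at hsum
  rw [← hsum]
  calc ‖∑ i ∈ Finset.range n, (f (q + (i : ℝ) • w + y + w) - f (q + (i : ℝ) • w + y) - f (q + (i : ℝ) • w + w)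
        + f (q + (i : ℝ) • w))‖
      ≤ ∑ i ∈ Finset.range n, ‖f (q + (i : ℝ) • w + y + w) - f (q + (i : ℝ) • w + y) - f (q + (i : ℝ) • w + w)
        + f (q + (i : ℝ) • w)‖ := norm_sum_le _ _
    _ ≤ ∑ _i ∈ Finset.range n, 2 * M * ‖y‖ ^ 2 := Finset.sum_le_sum hterm
    _ = n * (2 * M * ‖y‖ ^ 2) := by rw [Finset.sum_const, Finset.card_range, nsmul_eq_mul]
    _ ≤ (‖z‖ / ‖y‖ + 1) * (2 * M * ‖y‖ ^ 2) := mul_le_mul_of_nonneg_right hnle (by positivity)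
    _ ≤ (2 * (‖z‖ / ‖y‖)) * (2 * M * ‖y‖ ^ 2) := by
        refine mul_le_mul_of_nonneg_right ?_ (by positivity)
        have : 1 ≤ ‖z‖ / ‖y‖ := by rw [le_div_iff₀ hypos, one_mul]; exact hyz
        linarith
    _ = 4 * M * ‖y‖ * ‖z‖ := by field_simp; ring

end Literature.MathematicalPhysics.StatisticalMechanics.GradientRG

end
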